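import Mathlib
import Literature.Analysis.FunctionSpaces.SobolevDifferenceQuotients
import HarnessLib

/-!
# The DiPerna–Lions FIRST-ORDER commutator of a mollification: the uniform `L² × W^{1,2} → L¹` bound on `ℝⁿ`

Analysis/FunctionSpaces support file (everything proved; whole-space companion of the torus file
`SobolevCommutatorL1`, which treats the zeroth-order commutator `(θu) ⋆ k − (θ ⋆ k) u`).
For a scalar `θ ∈ L²`, a vector field `u ∈ W^{1,2}` (tree classes `MemSobolevDomain 1 2 ⊤`,
`HasWeakFDerivOn ⊤`) and a `C¹` compactly supported kernel `k` on a finite-dimensional real inner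
product space, the FIRST-ORDER COMMUTATOR
`R_k(x) = ∫ θ(y) ⟪u(x) − u(y), ∇k(x − y)⟫ dy = u·∇(θ ⋆ k)(x) − (div(uθ)) ⋆ k (x)`
(the object of DiPerna–Lions 1989, Lemma II.1: `[u·∇, k⋆]θ` up to the zeroth-order term `(θ div u) ⋆ k`)
satisfies the UNIFORM bound
`∫ ‖R_k(x)‖ dx ≤ (∫ ‖z‖‖∇k(z)‖ dz) · ‖θ‖_{L²} · ‖ |Du| ‖_{L²}`
(`lintegral_enorm_gradCommutator_le`).  For the rescaled kernels `k_ε = ε^{−n}k(ε⁻¹·)` the constant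
`∫ ‖z‖‖∇k_ε(z)‖ dz` does not depend on `ε`; this uniform bound is the half of Lemma II.1 that, together
with the smooth case, gives `R_{k_ε} → −θ div u` in `L¹` by density (not done here).
Proof: `|⟪u(x)−u(y), ∇k(x−y)⟫| ≤ ‖∇k(x−y)‖‖u(x)−u(y)‖`, Tonelli, the substitution `x = y + z`,
Cauchy–Schwarz in `y`, and the translation estimate for Sobolev functions
`‖u(· + z) − u‖_{L²} ≤ ‖Du z‖_{L²} ≤ ‖z‖ ‖|Du|‖_{L²}` (the tree's `eLpNorm_diffQuot_le`, Evans §5.8.2 Thm 3 (i)).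

## Mathlib / tree search
Mathlib (this pin): no commutator lemmas (`Mathlib/Analysis/Convolution`: none); Hölder
`ENNReal.lintegral_mul_le_Lp_mul_Lq`. Tree: `Torus.lintegral_enorm_mollifyCommutator_le`
(`SobolevCommutatorL1`, zeroth order, torus); `eLpNorm_diffQuot_le` (`SobolevDifferenceQuotients`).

## References
* R. J. DiPerna, P.-L. Lions, *Ordinary differential equations, transport theory and Sobolev spaces*,
  Invent. Math. 98 (1989), 511–547, Lemma II.1 and its proof. [`DiPernaLions1989`]
* L. Ambrosio, G. Crippa, *Existence, uniqueness, stability and differentiability properties of the flow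
  associated to weakly differentiable vector fields* (2008), Prop. 25 (the commutator estimate).
-/

noncomputable section

open MeasureTheory Set Filter Metric Function
open scoped ENNReal NNReal InnerProductSpace Topology RealInnerProductSpace

namespace Literature.Analysis.FunctionSpaces

variable {H : Type*} [NormedAddCommGroup H] [InnerProductSpace ℝ H] [FiniteDimensional ℝ H]
  [MeasurableSpace H] [BorelSpace H]

section GradCommutator

variable (μ : Measure H) [μ.IsAddHaarMeasure]

/-- **Translation estimate in `L²` for `W^{1,2}` fields on the whole space**:
`‖u(· + z) − u‖_{L²} ≤ ‖z‖ · ‖|Du|‖_{L²}` (the tree's `eLpNorm_diffQuot_le` — Evans §5.8.2 Thm 3 (i) — at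
`t = 1`, `v = z`, `Ω = Ω' = ⊤`, and `‖Du(y) z‖ ≤ ‖Du(y)‖‖z‖`). [cite: Evans2010, §5.8.2 Theorem 3 (i)] -/
theorem eLpNorm_sub_translate_le_norm_mul {F : Type*} [NormedAddCommGroup F] [NormedSpace ℝ F] [CompleteSpace F]
    {u : H → F} {Du : H → H →L[ℝ] F}
    (hu : MemSobolevDomain 1 2 (⊤ : TopologicalSpace.Opens H) μ u)
    (hDu : HasWeakFDerivOn (⊤ : TopologicalSpace.Opens H) μ u Du) (z : H) :
    eLpNorm (fun y => u (y + z) - u y) 2 μ ≤ ‖z‖ₑ * eLpNorm (fun y => ‖Du y‖) 2 μ := by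
  have h := eLpNorm_diffQuot_le μ (Ω := ⊤) (Ω' := ⊤) (p := 2) (by norm_num) ENNReal.ofNat_ne_top hu hDu
    (v := z) (t := 1) (fun y _ s _ => trivial)
  simp only [TopologicalSpace.Opens.coe_top, Measure.restrict_univ] at h
  have e : FunctionSpaces.diffQuot z 1 u = fun y => u (y + z) - u y := by
    funext y; simp [FunctionSpaces.diffQuot]
  rw [e] at h
  refine h.trans ?_
  have hle : ∀ y, ‖Du y z‖ ≤ ‖(‖z‖ • fun y => ‖Du y‖) y‖ := fun y => by
    rw [Pi.smul_apply, smul_eq_mul, Real.norm_of_nonneg (mul_nonneg (norm_nonneg _) (norm_nonneg _)), mul_comm]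
    exact (Du y).le_opNorm z
  calc eLpNorm (fun y => Du y z) 2 μ ≤ eLpNorm (‖z‖ • fun y => ‖Du y‖) 2 μ :=
        eLpNorm_mono fun y => hle y
    _ = ‖z‖ₑ * eLpNorm (fun y => ‖Du y‖) 2 μ := by
        rw [eLpNorm_const_smul, Real.enorm_eq_ofReal (norm_nonneg _), ofReal_norm]

variable {θ : H → ℝ} {u : H → H} {Du : H → H →L[ℝ] H} {k : H → ℝ}

/-- **THE DIPERNA–LIONS FIRST-ORDER COMMUTATOR BOUND (uniform `L² × W^{1,2} → L¹` form, whole space).**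
For `θ ∈ L²`, `u ∈ W^{1,2}` with weak gradient `Du`, and a `C¹` compactly supported kernel `k`:
`∫ ‖∫ θ(y) ⟪u(x) − u(y), ∇k(x − y)⟫ dy‖ dx ≤ (∫ ‖z‖‖∇k(z)‖ dz) · ‖θ‖_{L²} · ‖|Du|‖_{L²}`.
[cite: DiPernaLions1989, Lemma II.1 (proof)] -/
theorem lintegral_enorm_gradCommutator_le (hθ : MemLp θ 2 μ)
    (hu : MemSobolevDomain 1 2 (⊤ : TopologicalSpace.Opens H) μ u)
    (hDu : HasWeakFDerivOn (⊤ : TopologicalSpace.Opens H) μ u Du)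
    (hk : ContDiff ℝ 1 k) (hkc : HasCompactSupport k) :
    ∫⁻ x, ‖∫ y, θ y * ⟪u x - u y, gradient k (x - y)⟫ ∂μ‖ₑ ∂μ ≤
      ENNReal.ofReal (∫ z, ‖z‖ * ‖gradient k z‖ ∂μ) * eLpNorm θ 2 μ * eLpNorm (fun y => ‖Du y‖) 2 μ := by
  have hum : AEStronglyMeasurable u μ := by
    have h := hu.1.1
    rwa [TopologicalSpace.Opens.coe_top, Measure.restrict_univ] at h
  have hgk : Continuous (gradient k) := by
    have e : gradient k = fun x => (InnerProductSpace.toDual ℝ H).symm (fderiv ℝ k x) := rfl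
    rw [e]
    exact (InnerProductSpace.toDual ℝ H).symm.continuous.comp (hk.continuous_fderiv one_ne_zero)
  have hgs : HasCompactSupport (gradient k) := by
    have e : gradient k = (InnerProductSpace.toDual ℝ H).symm ∘ fderiv ℝ k := rfl
    rw [e]
    exact (hkc.fderiv (𝕜 := ℝ)).comp_left (map_zero _)
  set G := eLpNorm (fun y => ‖Du y‖) 2 μ with hG
  -- Step 1: pointwise, `|⟪u x − u y, ∇k(x−y)⟫| ≤ ‖∇k(x−y)‖‖u y − u x‖`
  have h1 : ∀ x, ‖∫ y, θ y * ⟪u x - u y, gradient k (x - y)⟫ ∂μ‖ₑ ≤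
      ∫⁻ y, ‖θ y‖ₑ * ‖gradient k (x - y)‖ₑ * ‖u y - u x‖ₑ ∂μ := fun x => by
    refine (enorm_integral_le_lintegral_enorm _).trans (lintegral_mono fun y => ?_)
    rw [enorm_mul, mul_assoc]
    gcongr
    have hr : ‖⟪u x - u y, gradient k (x - y)⟫‖ ≤ ‖gradient k (x - y)‖ * ‖u y - u x‖ := by
      rw [norm_sub_rev (u y) (u x), mul_comm]
      exact norm_inner_le_norm _ _
    calc ‖⟪u x - u y, gradient k (x - y)⟫‖ₑ = ENNReal.ofReal ‖⟪u x - u y, gradient k (x - y)⟫‖ := (ofReal_norm _).symm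
      _ ≤ ENNReal.ofReal (‖gradient k (x - y)‖ * ‖u y - u x‖) := ENNReal.ofReal_le_ofReal hr
      _ = ‖gradient k (x - y)‖ₑ * ‖u y - u x‖ₑ := by
          rw [ENNReal.ofReal_mul (norm_nonneg _), ofReal_norm, ofReal_norm]
  -- Step 2: Tonelli and the substitution `x = y + z`
  have hF : AEMeasurable (fun p : H × H => ‖θ p.2‖ₑ * ‖gradient k (p.1 - p.2)‖ₑ * ‖u p.2 - u p.1‖ₑ) (μ.prod μ) := by
    have hθ2 : AEStronglyMeasurable (fun p : H × H => θ p.2) (μ.prod μ) := hθ.1.comp_snd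
    have hu2 : AEStronglyMeasurable (fun p : H × H => u p.2) (μ.prod μ) := hum.comp_snd
    have hu1 : AEStronglyMeasurable (fun p : H × H => u p.1) (μ.prod μ) := hum.comp_fst
    have hkm : Measurable fun p : H × H => ‖gradient k (p.1 - p.2)‖ₑ :=
      (hgk.measurable.comp (measurable_fst.sub measurable_snd)).enorm
    exact (hθ2.enorm.mul hkm.aemeasurable).mul (hu2.sub hu1).enorm
  have h2 : ∫⁻ x, ∫⁻ y, ‖θ y‖ₑ * ‖gradient k (x - y)‖ₑ * ‖u y - u x‖ₑ ∂μ ∂μ =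
      ∫⁻ z, ‖gradient k z‖ₑ * ∫⁻ y, ‖θ y‖ₑ * ‖u (y + z) - u y‖ₑ ∂μ ∂μ := by
    rw [lintegral_lintegral_swap hF]
    have e1 : ∀ y, ∫⁻ x, ‖θ y‖ₑ * ‖gradient k (x - y)‖ₑ * ‖u y - u x‖ₑ ∂μ =
        ∫⁻ z, ‖θ y‖ₑ * ‖gradient k z‖ₑ * ‖u (y + z) - u y‖ₑ ∂μ := fun y => by
      have h := lintegral_add_right_eq_self (μ := μ) (fun x => ‖θ y‖ₑ * ‖gradient k (x - y)‖ₑ * ‖u y - u x‖ₑ) y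
      rw [← h]
      refine lintegral_congr fun z => ?_
      simp only [add_sub_cancel_right]
      rw [add_comm z y, enorm_sub_rev]
    simp_rw [e1]
    have hF2 : AEMeasurable (fun p : H × H => ‖θ p.1‖ₑ * ‖gradient k p.2‖ₑ * ‖u (p.1 + p.2) - u p.1‖ₑ) (μ.prod μ) := by
      have hθ1 : AEStronglyMeasurable (fun p : H × H => θ p.1) (μ.prod μ) := hθ.1.comp_fst
      have hu1 : AEStronglyMeasurable (fun p : H × H => u p.1) (μ.prod μ) := hum.comp_fst
      have huadd : AEStronglyMeasurable (fun p : H × H => u (p.1 + p.2)) (μ.prod μ) :=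
        hum.comp_quasiMeasurePreserving (quasiMeasurePreserving_add μ μ)
      have hkm : Measurable fun p : H × H => ‖gradient k p.2‖ₑ := (hgk.measurable.comp measurable_snd).enorm
      exact (hθ1.enorm.mul hkm.aemeasurable).mul (huadd.sub hu1).enorm
    rw [lintegral_lintegral_swap hF2]
    refine lintegral_congr fun z => ?_
    rw [← lintegral_const_mul' _ _ enorm_ne_top]
    refine lintegral_congr fun y => ?_
    ring
  -- Step 3: Cauchy–Schwarz in `y` and the translation estimate
  have h3 : ∀ z, ∫⁻ y, ‖θ y‖ₑ * ‖u (y + z) - u y‖ₑ ∂μ ≤ eLpNorm θ 2 μ * (‖z‖ₑ * G) := fun z => by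
    have hm : AEStronglyMeasurable (fun y => u (y + z) - u y) μ :=
      (hum.comp_measurePreserving (measurePreserving_add_right μ z)).sub hum
    have hcs := ENNReal.lintegral_mul_le_Lp_mul_Lq μ Real.HolderConjugate.two_two hθ.1.enorm hm.enorm
    refine hcs.trans ?_
    rw [eLpNorm_eq_lintegral_rpow_enorm_toReal two_ne_zero ENNReal.ofNat_ne_top]
    simp only [ENNReal.toReal_ofNat, one_div]
    gcongr
    have ht := eLpNorm_sub_translate_le_norm_mul μ hu hDu z
    rw [eLpNorm_eq_lintegral_rpow_enorm_toReal two_ne_zero ENNReal.ofNat_ne_top] at ht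
    simpa only [ENNReal.toReal_ofNat, one_div, hG] using ht
  -- Step 4: integrate in `z`
  have hint : Integrable (fun z => ‖z‖ * ‖gradient k z‖) μ :=
    (continuous_norm.mul hgk.norm).integrable_of_hasCompactSupport hgs.norm.mul_left
  calc ∫⁻ x, ‖∫ y, θ y * ⟪u x - u y, gradient k (x - y)⟫ ∂μ‖ₑ ∂μ
      ≤ ∫⁻ x, ∫⁻ y, ‖θ y‖ₑ * ‖gradient k (x - y)‖ₑ * ‖u y - u x‖ₑ ∂μ ∂μ := lintegral_mono h1
    _ = ∫⁻ z, ‖gradient k z‖ₑ * ∫⁻ y, ‖θ y‖ₑ * ‖u (y + z) - u y‖ₑ ∂μ ∂μ := h2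
    _ ≤ ∫⁻ z, ‖gradient k z‖ₑ * (eLpNorm θ 2 μ * (‖z‖ₑ * G)) ∂μ :=
        lintegral_mono fun z => mul_le_mul' le_rfl (h3 z)
    _ = (∫⁻ z, ‖z‖ₑ * ‖gradient k z‖ₑ ∂μ) * (eLpNorm θ 2 μ * G) := by
        have e : ∀ z, ‖gradient k z‖ₑ * (eLpNorm θ 2 μ * (‖z‖ₑ * G)) = ‖z‖ₑ * ‖gradient k z‖ₑ * (eLpNorm θ 2 μ * G) :=
          fun z => by ring
        simp_rw [e]
        exact lintegral_mul_const _ (measurable_id.enorm.mul hgk.measurable.enorm)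
    _ = ENNReal.ofReal (∫ z, ‖z‖ * ‖gradient k z‖ ∂μ) * eLpNorm θ 2 μ * G := by
        rw [← mul_assoc, ofReal_integral_eq_lintegral_ofReal hint
          (Eventually.of_forall fun z => mul_nonneg (norm_nonneg _) (norm_nonneg _))]
        congr 2
        refine lintegral_congr fun z => ?_
        rw [ENNReal.ofReal_mul (norm_nonneg _), ofReal_norm, ofReal_norm]

end GradCommutator

end Literature.Analysis.FunctionSpaces

end
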